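import Literature.Probability.Percolation.NearCriticalOneArmFromThreeFacts
import Literature.Probability.Percolation.HalfPlaneTwoArmRadii
import HarnessLib

/-!
# Werner's one-arm stability below `L(p)` from the two remaining named facts (assembly, proofs only)

Topic `Literature/Probability/Percolation`; family `crit-perc`. PROOFS ONLY (no definition, no
named fact): the state of the discharge of the named fact `Werner2009_oneArm_nearCritical`
(`WernerCorrelationLength.lean`; W. Werner, *Lectures on two-dimensional critical percolation*,
IAS/Park City Math. Ser. 16 (2009), Lecture 6, §5, "Using differential inequalities for the
one-arm event": `P_p(0 ↔ ∂Λ_n) ≍ P_{1/2}(0 ↔ ∂Λ_n)` uniformly for `n ≤ L(p)`; originally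
H. Kesten, *Comm. Math. Phys.* 109 (1987), Thm. 1).

`WernerOneArmStability.lean` derives `Werner2009_oneArm_nearCritical` from FOUR named facts of
Kesten's near-critical arm calculus in Werner's form (Lecture 6, §3–§4):
`Werner2009_fourArm_quasiMult` (Cor. 6.2), `Werner2009_fourArm_lowerBound` (§3, third a priori
estimate), `Nolin2008_halfPlane_twoArm` (the half-plane two-arm bound, Nolin 2008, Thm. 24 (i))
and `Werner2009_pivotal_lowerBound` (proof of Lemma 6.2, interior points)
(`Werner2009_oneArm_nearCritical_of_facts4`); `NearCriticalOneArmFromThreeFacts.lean` fed in the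
theorem `Werner2009_fourArm_lowerBound_holds` (`FiveArmLowerBound.lean`). The half-plane two-arm
bound is a theorem of the tree as well (`Nolin2008_halfPlane_twoArm_holds`,
`HalfPlaneTwoArmRadii.lean`: Kesten's inner separation for the half-plane two-arm event), and this
file feeds it in: `Werner2009_oneArm_nearCritical` now follows from the TWO remaining named facts

* `Werner2009_fourArm_quasiMult` — quasi-multiplicativity of the four-arm probability
  `π̂_t(r, R) = fourArmProbAt t r R` below `L(t, ε)` (Werner 2009, Cor. 6.2, the consequence of
  the arm-separation Prop. 6.1), and
* `Werner2009_pivotal_lowerBound` — interior sites of the `2N × N` parallelogram are pivotal for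
  its left–right crossing with probability `≥ cst · π̂_t(r₀, N)` below `L(t, ε)` (Werner 2009,
  proof of Lemma 6.2, lower bound),

both resting on Kesten's four-arm separation below `L(p)` (Werner 2009, Prop. 6.1; Nolin 2008,
Thm. 11 and Prop. 12–13 [arXiv 0711.4948: Thm. 10, Prop. 11–12]; Kesten 1987, Lemmas 4–6), which
the tree does not have at `p ≠ 1/2` (at `p = 1/2` and for four arms the gluing half is
`ArmSeparationFourArmProofs.lean`, with the separation itself as a hypothesis). The discharge
`Werner2009_oneArm_nearCritical_holds` is `Werner2009_oneArm_nearCritical_of_facts2` applied to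
`Werner2009_fourArm_quasiMult_holds` and `Werner2009_pivotal_lowerBound_holds` once these exist.

Remark on the two remaining facts (recorded for whoever discharges them). Both are stated with
the tree's four-arm probability `fourArmProbAt t r R = P_t(armEvent ![true, false, true, false] r R)`,
whose event does not prescribe the cyclic order of the colours and therefore contains, besides
Werner's alternating pattern, the "adjacent" pattern (two open arms side by side). As explained
in the module docstring of `NearCriticalFourArmFacts.lean`, below `L(p)` the two patterns have
comparable probabilities only through Nolin 2008, Thm. 27 (stability of each pattern) and
Prop. 20 (colour switching at `p = 1/2`) [arXiv 0711.4948: Thm. 26, Prop. 19], so that a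
discharge of either fact needs Kesten's separation (and the resulting stability) for BOTH cyclic
patterns, not only for the alternating one that Werner's `π̂_p` denotes.

## References

* W. Werner, *Lectures on two-dimensional critical percolation*, IAS/Park City Math. Ser. 16
  (2009), Lecture 6, §3, §4 (Prop. 6.1, Cor. 6.2), Lemma 6.2, §5 ("Using differential
  inequalities for the one-arm event", arXiv 0710.0856 p. 65) [WernerPCMI2009].
* P. Nolin, Near-critical percolation in two dimensions, *Electron. J. Probab.* 13 (2008)
  1562–1623, Thm. 11, Prop. 12–13, Thm. 24 (i), Thm. 27, Prop. 20 (arXiv 0711.4948: Thm. 10,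
  Prop. 11–12, Thm. 23 (i), Thm. 26, Prop. 19) [Nolin2008].
* H. Kesten, Scaling relations for 2D-percolation, *Comm. Math. Phys.* 109 (1987) 109–156,
  Thm. 1, Lemmas 4–6 [KestenScalingCMP1987].

Tree: `Werner2009_oneArm_nearCritical_of_facts3` (`NearCriticalOneArmFromThreeFacts.lean`),
`Werner2009_oneArm_nearCritical_of_facts4` (`WernerOneArmStability.lean`),
`Nolin2008_halfPlane_twoArm_holds` (`HalfPlaneTwoArmRadii.lean`),
`Werner2009_fourArm_lowerBound_holds` (`FiveArmLowerBound.lean`), the two remaining named facts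
(`NearCriticalFourArmFacts.lean`, `NearCriticalBoundaryFacts.lean`). Mathlib: nothing beyond the
imports of these files.
-/

namespace Literature.Probability.Percolation

/-- **Werner's one-arm stability below `L(p)` from the two remaining named facts** (Werner 2009,
Lecture 6, §5: `P_p(0 ↔ ∂Λ_n) ≍ P_{1/2}(0 ↔ ∂Λ_n)` for `n ≤ L(p)`):
`Werner2009_oneArm_nearCritical_of_facts3` with the half-plane two-arm bound supplied by the
theorem `Nolin2008_halfPlane_twoArm_holds`; the four-arm lower bound was already supplied there by
`Werner2009_fourArm_lowerBound_holds`. The remaining hypotheses are the four-arm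
quasi-multiplicativity below `L(p)` (Cor. 6.2) and the pivotal lower bound of the proof of
Lemma 6.2, i.e. the two consequences of Kesten's four-arm separation below `L(p)` (Prop. 6.1).
The discharge `Werner2009_oneArm_nearCritical_holds` is this theorem applied to the two `_holds`
once they land. [cite: WernerPCMI2009, Lecture 6, §5 ("Using differential inequalities for the one-arm event"), with Prop. 6.1, Cor. 6.2 and Lemma 6.2] [cite: KestenScalingCMP1987, Thm. 1] -/
theorem Werner2009_oneArm_nearCritical_of_facts2 (hQM : Werner2009_fourArm_quasiMult)
    (hP : Werner2009_pivotal_lowerBound) : Werner2009_oneArm_nearCritical :=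
  Werner2009_oneArm_nearCritical_of_facts3 hQM Nolin2008_halfPlane_twoArm_holds hP

end Literature.Probability.Percolation
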